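import Mathlib.Geometry.Manifold.PartitionOfUnity
import HarnessLib

/-!
# Smooth exhaustion functions (Lee, Prop. 2.28)

Topic `Literature/Geometry/Manifold`; general infrastructure. An *exhaustion function* on a
topological space `M` is a continuous `f : M → ℝ` all of whose sublevel sets
`f ⁻¹' (-∞, c]` are compact (Lee, *Introduction to Smooth Manifolds*, 2nd ed. (2013), p. 46);
equivalently (on a Hausdorff space, for continuous `f`) `f` tends to `+∞` along the cocompact
filter. We prove:

* `Literature.Geometry.Manifold.exists_contMDiff_tendsto_cocompact_atTop` — **existence of smooth
  positive exhaustion functions** (Lee 2013, Prop. 2.28): every `C^∞` manifold `M` (Hausdorff,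
  σ-compact, finite-dimensional model, possibly with boundary or corners) carries a `C^∞`
  function `f : M → ℝ` with `1 ≤ f` and `Tendsto f (cocompact M) atTop`;
* `Literature.Geometry.Manifold.exists_contMDiff_isCompact_preimage_Iic` — the same with the
  conclusion "all sublevel sets are compact".

Proof (Lee, loc. cit.): for a countable cover by precompact open sets `V j` — here the interiors
of a compact exhaustion `K`, `V j = interior (K (j + 1))` — and a smooth partition of unity `ψ`
subordinate to it (Mathlib's `SmoothPartitionOfUnity.exists_isSubordinate`), put
`f = ∑ j, j • ψ j + 1`; if `p ∉ K N` then `ψ j p = 0` for `j < N` (as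
`tsupport (ψ j) ⊆ K (j+1) ⊆ K N`), so `f p ≥ N ∑ ψ j p + 1 > N`; hence
`{f ≤ N} ⊆ K N`.

This is the first sentence of the handle decomposition of open manifolds (Phillips 1967,
Lemma 1.1: "First realize `M` as an expanding union of compact manifolds …"; Milnor, *Morse
theory*, §6) and is recorded here because Mathlib has smooth partitions of unity but not this
consequence (`rg "cocompact" Mathlib/Geometry/Manifold`: nothing).

## References

* J. M. Lee, *Introduction to Smooth Manifolds*, 2nd ed., GTM 218, Springer (2013), Prop. 2.28
  (p. 46). [LeeSmoothManifolds2013] (held: `book:lee2012-introduction-smooth-manifolds`, p0075)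
* A. Phillips, *Submersions of open manifolds*, Topology 6 (1967), Lemma 1.1 (p. 176).
  [Phillips1967]
-/

open scoped Manifold ContDiff Topology
open Set Function Filter

noncomputable section

namespace Literature.Geometry.Manifold

variable {E : Type*} [NormedAddCommGroup E] [NormedSpace ℝ E] [FiniteDimensional ℝ E]
  {H : Type*} [TopologicalSpace H] {I : ModelWithCorners ℝ E H}
  {M : Type*} [TopologicalSpace M] [ChartedSpace H M] [IsManifold I ∞ M]
  [T2Space M] [SigmaCompactSpace M] [LocallyCompactSpace M]

/-- **Existence of smooth exhaustion functions** (Lee 2013, Prop. 2.28). On a `C^∞` manifold `M`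
(Hausdorff, σ-compact, locally compact, finite-dimensional model; boundary and corners allowed)
there is a `C^∞` function `f : M → ℝ` with `1 ≤ f` which tends to `+∞` along the cocompact
filter, i.e. a smooth positive exhaustion function: `f = 1 + ∑ j, j • ψ j` for a smooth
partition of unity `ψ` subordinate to the interiors of a compact exhaustion.
[cite: LeeSmoothManifolds2013, Prop. 2.28] -/
theorem exists_contMDiff_tendsto_cocompact_atTop :
    ∃ f : M → ℝ, ContMDiff I 𝓘(ℝ) ∞ f ∧ (∀ x, 1 ≤ f x) ∧
      Tendsto f (cocompact M) atTop := by
  classical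
  set K : CompactExhaustion M := CompactExhaustion.choice M with hK
  -- the open cover by the interiors of the exhaustion
  set V : ℕ → Set M := fun j => interior (K (j + 1)) with hV
  have hVo : ∀ j, IsOpen (V j) := fun j => isOpen_interior
  have hVU : (univ : Set M) ⊆ ⋃ j, V j := by
    intro x _
    obtain ⟨j, hj⟩ := K.exists_mem x
    exact mem_iUnion.2 ⟨j, K.subset_interior_succ j hj⟩
  obtain ⟨ψ, hψ⟩ := SmoothPartitionOfUnity.exists_isSubordinate I isClosed_univ V hVo hVU
  -- supports: `ψ j x ≠ 0 → x ∈ K (j + 1)`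
  have hsupp : ∀ j x, ψ j x ≠ 0 → x ∈ K (j + 1) := fun j x hx =>
    interior_subset (hψ j (subset_tsupport _ (mem_support.2 hx)))
  set f : M → ℝ := fun x => (∑ᶠ j, ψ j x • ((j : ℕ) : ℝ)) + 1 with hf
  refine ⟨f, ?_, fun x => ?_, ?_⟩
  · -- smoothness: a locally finite sum of smooth functions
    refine ContMDiff.add ?_ contMDiff_const
    exact ψ.contMDiff_finsum_smul (g := fun j _ => ((j : ℕ) : ℝ))
      fun j x _ => contMDiffAt_const
  · -- positivity
    have h0 : 0 ≤ ∑ᶠ j, ψ j x • ((j : ℕ) : ℝ) :=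
      finsum_nonneg fun j => smul_nonneg (ψ.nonneg j x) (Nat.cast_nonneg j)
    simp only [hf]
    linarith
  · -- exhaustion: outside `K N` every nonzero term has index `j ≥ N`, so `f ≥ N + 1`
    have hbound : ∀ (N : ℕ) (x : M), x ∉ K N → (N : ℝ) + 1 ≤ f x := by
      intro N x hx
      have hfin : (support fun j => ψ j x).Finite := ψ.locallyFinite.point_finite x
      have hsum1 : ∑ᶠ j, ψ j x = 1 := ψ.sum_eq_one (mem_univ x)
      -- compare termwise: `ψ j x • N ≤ ψ j x • j` whenever `ψ j x ≠ 0`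
      have hle : ∀ j, ψ j x • (N : ℝ) ≤ ψ j x • ((j : ℕ) : ℝ) := by
        intro j
        by_cases hj : ψ j x = 0
        · simp [hj]
        · have hxK : x ∈ K (j + 1) := hsupp j x hj
          have hNj : N ≤ j := by
            by_contra hlt
            exact hx (K.subset (by omega) hxK)
          exact smul_le_smul_of_nonneg_left (by exact_mod_cast hNj) (ψ.nonneg j x)
      have hs1 : (support fun j => ψ j x • (N : ℝ)) ⊆ hfin.toFinset := by
        intro j hj
        simp only [Finite.coe_toFinset, mem_support]
        intro h0
        exact hj (by simp [h0])
      have hs2 : (support fun j => ψ j x • ((j : ℕ) : ℝ)) ⊆ hfin.toFinset := by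
        intro j hj
        simp only [Finite.coe_toFinset, mem_support]
        intro h0
        exact hj (by simp [h0])
      have hs0 : (support fun j => ψ j x) ⊆ hfin.toFinset := by simp
      have key : ∑ᶠ j, ψ j x • (N : ℝ) ≤ ∑ᶠ j, ψ j x • ((j : ℕ) : ℝ) := by
        rw [finsum_eq_sum_of_support_subset _ hs1, finsum_eq_sum_of_support_subset _ hs2]
        exact Finset.sum_le_sum fun j _ => hle j
      have hN : ∑ᶠ j, ψ j x • (N : ℝ) = N := by
        rw [finsum_eq_sum_of_support_subset _ hs1, ← Finset.sum_smul, smul_eq_mul,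
          ← finsum_eq_sum_of_support_subset _ hs0, hsum1, one_mul]
      simp only [hf]
      linarith
    -- conclude with the bases of `cocompact` and `atTop`
    rw [(hasBasis_cocompact (X := M)).tendsto_iff atTop_basis]
    intro b _
    obtain ⟨N, hN⟩ := exists_nat_ge b
    exact ⟨K N, K.isCompact N, fun x hx => le_trans hN (by linarith [hbound N x hx])⟩

/-- **Smooth exhaustion functions, sublevel form** (Lee 2013, Prop. 2.28): a `C^∞` function
`f ≥ 1` on `M` all of whose sublevel sets `{x | f x ≤ c}` are compact.
[cite: LeeSmoothManifolds2013, Prop. 2.28] -/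
theorem exists_contMDiff_isCompact_preimage_Iic :
    ∃ f : M → ℝ, ContMDiff I 𝓘(ℝ) ∞ f ∧ (∀ x, 1 ≤ f x) ∧
      ∀ c : ℝ, IsCompact (f ⁻¹' Iic c) := by
  obtain ⟨f, hf, h1, ht⟩ := exists_contMDiff_tendsto_cocompact_atTop (I := I) (M := M)
  refine ⟨f, hf, h1, fun c => ?_⟩
  rw [(hasBasis_cocompact (X := M)).tendsto_iff atTop_basis] at ht
  obtain ⟨K, hK, hKf⟩ := ht (c + 1) trivial
  refine hK.of_isClosed_subset (isClosed_Iic.preimage hf.continuous) fun x hx => ?_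
  by_contra hxK
  have h1 : c + 1 ≤ f x := hKf x hxK
  have h2 : f x ≤ c := hx
  linarith
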